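import Summits.Ventures.HSemireg.WedgeHankelSubstitutionJordanPartition
import Summits.Ventures.HSemireg.WedgeHankelSubstitutionParabolicCharP

/-!
# Venture HSemireg — EVERY PARABOLIC SUBSTITUTION HAS THE FULL JORDAN TYPE `(p, …, p, n % p + 1)` OF THE SHEAR ON TH-7's CLASSES IN CHARACTERISTIC `p`:
# `dim ker (SbC(g) − a^n)^k = ⌊n/p⌋·min(k, p) + min(k, n % p + 1)` for a parabolic `g` with double node (finite or `∞`) and multiplier `a`, and for the lower shear,
# by J11's conjugation `(SbC(g) − a^n)·Q = Q·(a^n • (SbC(shear) − 1))` carried to all powers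

HONEST FRAMING. Part of the Lean index of the computation cell `pub-hsemireg` (seat p10 gen 21, Sunday typer «UNIFORM-IN-n»).
Finite-dimensional EXTERIOR ALGEBRA + linear algebra ONLY: no variety, no cohomology theory, no sheaf, no Ext group, no semiregularity map;
nothing here says that HC / HC_CM / HC_AV holds; no Literature fact is declared or used.  Custodian versions as in `WedgeHankelSiegelIdeal` (1/3) and `WedgeHankelFrameChange`;
the dictionary (a parabolic element of `GL₂` is conjugate to a scalar times a shear; Jordan types are conjugation invariants) is QUOTED, never asserted.

WHAT IS IN THE TREE.  K1 (`WedgeHankelSubstitutionJordanPartition`, this seat): `finrank_ker_SbC_shear_sub_one_pow_char` (the shear: `dim ker N^k = (n/p)·min(k,p) + min(k, n%p+1)`);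
J11 (`WedgeHankelSubstitutionParabolicCharP`): `SbC_sub_mul_conj_of_parabolic` (the conjugation), `conj_mul_inv` / `inv_mul_conj`, `finrank_ker_eq_of_conj`, `SbC_upper_parabolic`,
`SbC_lower_shear_eq_swap_conj`, `SbC_swap_mul_swap`; J4/J11 typed only `k = 1` and the nilpotency index.  THIS FILE (namespace `Summit.Ventures.HSemireg.Wedge.HankelFrameChange`
continued; imports K1 + J11) carries the conjugation to all powers:
* §279 `pow_mul_eq_mul_pow_of_mul_eq` (`A·Q = Q·B ⇒ A^k·Q = Q·B^k`), **`finrank_ker_pow_eq_of_conj`** (`dim ker A^k = dim ker B^k` for `Q` invertible), `smul_sub_one_pow`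
  / `ker_smul_pow` (`ker (c • N)^k = ker N^k`, `c ≠ 0`).
* §280 **`finrank_ker_SbC_sub_pow_of_parabolic`** (every field: `dim ker (SbC(g) − a^n)^k = dim ker (SbC(shear γ/a) − 1)^k` for a parabolic `g` with finite double node `λ₁`,
  `a = α + λ₁γ ≠ 0`), **`finrank_ker_SbC_sub_pow_of_parabolic_char`** (characteristic `p`, `γ ≠ 0`: `= (n/p)·min(k,p) + min(k, n%p+1)` — Jordan type `(p,…,p, n%p+1)`),
  **`finrank_ker_SbC_upper_parabolic_sub_pow_char`** (`SbC(α β 0 α)`, `β ≠ 0`: the same), **`finrank_ker_SbC_lower_shear_sub_one_pow`** (every field: the lower shear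
  `SbC(1 0 c 1)` has the kernel dimensions of the upper shear `SbC(1 c 0 1)`, swap-conjugate) and **`finrank_ker_SbC_lower_shear_sub_one_pow_char`**.
NOT typed here: parabolic `g` with an inseparable (non-`K`-rational) double node in characteristic `2`; anything Ext-side.  New names only.
-/

open Module

namespace Summit.Ventures.HSemireg.Wedge.HankelFrameChange

open Summit.Ventures.HSemireg.Wedge Summit.Ventures.HSemireg.Wedge.Kunneth Summit.Ventures.HSemireg.Wedge.Hankel
  Summit.Ventures.HSemireg.Wedge.BasisFree Summit.Ventures.HSemireg.Wedge.HankelSiegel Summit.Ventures.HSemireg.Wedge.HankelSiegelIdeal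
  Summit.Ventures.HSemireg.Wedge.KunnethKernel Summit.Ventures.HSemireg.Wedge.HankelRankOne Summit.Ventures.HSemireg.Wedge.KernelDuality

variable (K : Type*) [Field K] {n : ℕ}

/-! ## §279. Conjugation carries kernel dimensions of all powers -/

section Conj

variable {V : Type*} [AddCommGroup V] [Module K V]

/-- `A·Q = Q·B ⇒ A^k·Q = Q·B^k`. -/
theorem pow_mul_eq_mul_pow_of_mul_eq {A B Q : Module.End K V} (h : A * Q = Q * B) (k : ℕ) : A ^ k * Q = Q * B ^ k := by
  induction k with
  | zero => rw [pow_zero, pow_zero, one_mul, mul_one]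
  | succ k ih => rw [pow_succ, mul_assoc, h, ← mul_assoc, ih, mul_assoc, ← pow_succ]

/-- **`dim ker A^k = dim ker B^k` for conjugate endomorphisms** (`A·Q = Q·B`, `Q·Q′ = Q′·Q = 1`; J11 `finrank_ker_eq_of_conj` at every power). -/
theorem finrank_ker_pow_eq_of_conj [FiniteDimensional K V] {A B Q Q' : Module.End K V} (h : A * Q = Q * B) (hQ : Q * Q' = 1) (hQ' : Q' * Q = 1) (k : ℕ) :
    finrank K ↥(LinearMap.ker (A ^ k)) = finrank K ↥(LinearMap.ker (B ^ k)) :=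
  finrank_ker_eq_of_conj K (pow_mul_eq_mul_pow_of_mul_eq K h k) hQ hQ'

/-- `ker (c • N)^k = ker N^k` for `c ≠ 0`. -/
theorem ker_smul_pow {N : Module.End K V} {c : K} (hc : c ≠ 0) (k : ℕ) : LinearMap.ker ((c • N) ^ k) = LinearMap.ker (N ^ k) := by
  rw [smul_pow, LinearMap.ker_smul _ _ (pow_ne_zero k hc)]

/-- `c • N − c • 1 = c • (N − 1)` as endomorphisms. -/
theorem smul_sub_smul_one (N : Module.End K V) (c : K) : c • N - c • (1 : Module.End K V) = c • (N - 1) := by rw [smul_sub]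

end Conj

/-! ## §280. Parabolic substitutions and the lower shear -/

/-- **every field: `dim ker (SbC(g) − a^n)^k = dim ker (SbC(shear γ/a) − 1)^k` for a PARABOLIC `g`** — fixed node `λ₁` (`β + λ₁δ = λ₁(α+λ₁γ)`), double (`δ − λ₁γ = α + λ₁γ = a ≠ 0`)
(J11's conjugation at every power). -/
theorem finrank_ker_SbC_sub_pow_of_parabolic {α β γ δ l₁ : K} (e₁ : β + l₁ * δ = l₁ * (α + l₁ * γ)) (hpar : δ - l₁ * γ = α + l₁ * γ) (ha : α + l₁ * γ ≠ 0) (k : ℕ) :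
    finrank K ↥(LinearMap.ker ((SbC K α β γ δ (n := n) - (α + l₁ * γ) ^ n • 1) ^ k)) = finrank K ↥(LinearMap.ker ((SbC K 1 (γ / (α + l₁ * γ)) 0 1 (n := n) - 1) ^ k)) := by
  rw [finrank_ker_pow_eq_of_conj K (SbC_sub_mul_conj_of_parabolic K e₁ hpar ha) (conj_mul_inv K l₁) (inv_mul_conj K l₁) k, ker_smul_pow K (pow_ne_zero n ha)]

/-- **CHARACTERISTIC `p`, PARABOLIC `g` WITH `γ ≠ 0`: `dim ker (SbC(g) − a^n)^k = (n / p)·min(k, p) + min(k, n % p + 1)`** — the Jordan type of `SbC(g) − a^n` on th-7's classes is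
`(p, …, p, n % p + 1)`, the same as the shear's (K1). -/
theorem finrank_ker_SbC_sub_pow_of_parabolic_char {α β γ δ l₁ : K} (e₁ : β + l₁ * δ = l₁ * (α + l₁ * γ)) (hpar : δ - l₁ * γ = α + l₁ * γ) (ha : α + l₁ * γ ≠ 0) (hγ : γ ≠ 0)
    (p : ℕ) [Fact p.Prime] [CharP K p] (k : ℕ) :
    finrank K ↥(LinearMap.ker ((SbC K α β γ δ (n := n) - (α + l₁ * γ) ^ n • 1) ^ k)) = n / p * min k p + min k (n % p + 1) := by
  rw [finrank_ker_SbC_sub_pow_of_parabolic K e₁ hpar ha, finrank_ker_SbC_shear_sub_one_pow_char K (div_ne_zero hγ ha) p k]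

/-- **THE DOUBLE NODE AT `∞`: `dim ker (SbC(α β 0 α) − α^n)^k = (n / p)·min(k, p) + min(k, n % p + 1)`** in characteristic `p` (`α ≠ 0`, `β ≠ 0`; J11 `SbC_upper_parabolic`). -/
theorem finrank_ker_SbC_upper_parabolic_sub_pow_char {α β : K} (hα : α ≠ 0) (hβ : β ≠ 0) (p : ℕ) [Fact p.Prime] [CharP K p] (k : ℕ) :
    finrank K ↥(LinearMap.ker ((SbC K α β 0 α (n := n) - α ^ n • 1) ^ k)) = n / p * min k p + min k (n % p + 1) := by
  rw [SbC_upper_parabolic K hα, smul_sub_smul_one, ker_smul_pow K (pow_ne_zero n hα), finrank_ker_SbC_shear_sub_one_pow_char K (div_ne_zero hβ hα) p k]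

/-- **every field: the LOWER SHEAR `SbC(1 0 c 1)` has the kernel dimensions of the upper shear `SbC(1 c 0 1)` at every power** (swap-conjugate, J11
`SbC_lower_shear_eq_swap_conj`, `SbC_swap_mul_swap`). -/
theorem finrank_ker_SbC_lower_shear_sub_one_pow (c : K) (k : ℕ) :
    finrank K ↥(LinearMap.ker ((SbC K 1 0 c 1 (n := n) - 1) ^ k)) = finrank K ↥(LinearMap.ker ((SbC K 1 c 0 1 (n := n) - 1) ^ k)) := by
  refine finrank_ker_pow_eq_of_conj K (Q := SbC K 0 1 1 0) (Q' := SbC K 0 1 1 0) ?_ (SbC_swap_mul_swap K) (SbC_swap_mul_swap K) k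
  have hSS : ∀ g : spikeSpan K n, SbC K 0 1 1 0 (SbC K 0 1 1 0 g) = g := fun g => by
    rw [← Module.End.mul_apply, SbC_swap_mul_swap, Module.End.one_apply]
  refine LinearMap.ext fun f => ?_
  simp only [Module.End.mul_apply, LinearMap.sub_apply, Module.End.one_apply, map_sub, SbC_lower_shear_eq_swap_conj K c, hSS]

/-- **CHARACTERISTIC `p`: the lower shear `SbC(1 0 c 1)`, `c ≠ 0`, has Jordan type `(p, …, p, n % p + 1)` on th-7's classes:
`dim ker (SbC(1 0 c 1) − 1)^k = (n / p)·min(k, p) + min(k, n % p + 1)`.** -/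
theorem finrank_ker_SbC_lower_shear_sub_one_pow_char {c : K} (hc : c ≠ 0) (p : ℕ) [Fact p.Prime] [CharP K p] (k : ℕ) :
    finrank K ↥(LinearMap.ker ((SbC K 1 0 c 1 (n := n) - 1) ^ k)) = n / p * min k p + min k (n % p + 1) := by
  rw [finrank_ker_SbC_lower_shear_sub_one_pow, finrank_ker_SbC_shear_sub_one_pow_char K hc p k]

/-- **every scalar multiple of a shear, `SbC(a aλ 0 a)` with `a, λ ≠ 0`, and every `K`-rational parabolic `g`: the number of Jordan blocks of `SbC(g) − a^n` of size `> k`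
is `⌊n/p⌋ + [k ≤ n % p]`** (`k < p`; differences of the kernel dimensions, K1 `finrank_range_pow_inf_ker_SbC_shear_char` transported) — stated for the parabolic `g` with
`γ ≠ 0` as `dim ker A^{k+1} = dim ker A^k + (⌊n/p⌋ + [k ≤ n % p])`. -/
theorem finrank_ker_SbC_sub_pow_succ_of_parabolic_char {α β γ δ l₁ : K} (e₁ : β + l₁ * δ = l₁ * (α + l₁ * γ)) (hpar : δ - l₁ * γ = α + l₁ * γ) (ha : α + l₁ * γ ≠ 0)
    (hγ : γ ≠ 0) (p : ℕ) [Fact p.Prime] [CharP K p] {k : ℕ} (hk : k < p) :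
    finrank K ↥(LinearMap.ker ((SbC K α β γ δ (n := n) - (α + l₁ * γ) ^ n • 1) ^ (k + 1))) =
      finrank K ↥(LinearMap.ker ((SbC K α β γ δ (n := n) - (α + l₁ * γ) ^ n • 1) ^ k)) + (n / p + if k ≤ n % p then 1 else 0) := by
  rw [finrank_ker_SbC_sub_pow_of_parabolic_char K e₁ hpar ha hγ p, finrank_ker_SbC_sub_pow_of_parabolic_char K e₁ hpar ha hγ p, min_eq_left hk.le,
    min_eq_left (Nat.succ_le_of_lt hk), Nat.mul_succ]
  set e := n / p
  set f := e * k
  by_cases hks : k ≤ n % p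
  · rw [if_pos hks, min_eq_left (by omega : k + 1 ≤ n % p + 1), min_eq_left (by omega : k ≤ n % p + 1)]; omega
  · rw [if_neg hks, min_eq_right (by omega : n % p + 1 ≤ k + 1), min_eq_right (by omega : n % p + 1 ≤ k)]; omega

end Summit.Ventures.HSemireg.Wedge.HankelFrameChange
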